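import Literature.Combinatorics.Sahi2008.Functional
import HarnessLib

/-!
# The without-replacement companion `Ẽ_n` of Sahi's functional on a product of two finite sets (definitions)

Support file of the one-cut programme (crux `NoHeavyLowerTail`, stmt-CriticalPhenomena-4575; cell `prim-masterthm`, seat P3, gen 16;
`run/shared/lean/prim/prim-masterthm/prim-masterthm-p3/HIERARCHY.md` §24; memo
`run/shared/lean/prim/prim-masterthm/FROM-prim-masterthm-p3-g16-TWO-CHAIN-COEFFICIENTS.md`).

PURPOSE.  For probability weights `ν` on `α` and `ν'` on `β`, Sahi's `E_n^{ν⊗ν'}(f_0,…,f_{n−1})` is a polynomial in the point masses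
`(ν_x)`, `(ν'_y)`.  Its COEFFICIENTS (after bi-homogenisation) are the values of a second functional `Ẽ_n`, in which the `|π|` blocks of a
set partition are read at `|π|` points of the grid with DISTINCT first coordinates and DISTINCT second coordinates ("sampling without
replacement in both coordinates", a uniformly random partial permutation pattern) instead of at independent points.  This file defines
`Ẽ_n` — `SahiTwoChain.et X Y n f` for finite sets `X ⊆ α`, `Y ⊆ β` of admissible coordinates — by the analogue of the Lieb–Sahi recursion
[LiebSahi2021, Prop. 3.3] in which the product term lives on the REDUCED grid `(X ∖ {x}) × (Y ∖ {y})`: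
`Ẽ^{X×Y}_{n+2}(f, g_0..g_n) = Σ_i Ẽ^{X×Y}_{n+1}(g with g_i ↦ g_i f) − (1/|X||Y|) Σ_{(x,y)∈X×Y} f(x,y)·Ẽ^{(X∖x)×(Y∖y)}_{n+1}(g)`,
`Ẽ^{X×Y}_1(f) = (1/|X||Y|) Σ_{z∈X×Y} f(z)`, junk value `Ẽ_0 := 0`; and the auxiliary one-dimensional average `chainAvg` used for nested
families (the without-replacement form of the Lieb–Sahi chain product formula [LiebSahi2021, Lemma 3.2]).  Everything else (multilinearity,
symmetry, invariance, the chain case, the Lieb–Sahi induction on staircases, and the identification of `E_n^{ν⊗ν'}` as a nonnegative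
combination of values of `Ẽ_n`) is in the companion files `…SahiTwoChainWRSymmetry/Chain/Induction/Coefficients.lean`.
JUNK VALUES: when `|X| < n` or `|Y| < n` the recursion still produces a number, which is NOT the pattern average (documented; every theorem
about `et` carries the hypotheses `n ≤ |X|`, `n ≤ |Y|` it needs). [this work]
-/

noncomputable section

open scoped Classical

namespace Summit.CriticalPhenomena.PercolationContinuityZ3.Theorems

open Finset Function
open Literature.Combinatorics.Sahi2008

namespace SahiTwoChain

variable {α β : Type*}

/-- **The without-replacement functional `Ẽ^{X×Y}_n(f_0,…,f_{n−1})`** on the grid `X × Y` (`X ⊆ α`, `Y ⊆ β` finite), defined by the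
Lieb–Sahi-type recursion with the distinguished function in slot `0` and the product term on the reduced grid:
`Ẽ_{n+2}(f_0, g) = Σ_i Ẽ_{n+1}(g_0,…,g_i f_0,…,g_n) − (Σ_{z∈X×Y} f_0(z)·Ẽ^{(X∖z.1)×(Y∖z.2)}_{n+1}(g)) / (|X||Y|)`, `Ẽ_1(f) = (Σ_{z∈X×Y} f z)/(|X||Y|)`,
`Ẽ_0 := 0` (junk).  For `n ≤ min(|X|,|Y|)` this is `Σ_π (−1)^{|π|−1} Π_B (|B|−1)! · 𝔼[Π_B (Π_{j∈B} f_j)(P_B)]` with `(P_B)_B` a uniformly random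
family of points of `X × Y` with pairwise distinct first and pairwise distinct second coordinates. [this work] -/
def et : Finset α → Finset β → (n : ℕ) → (Fin n → α × β → ℝ) → ℝ
  | _, _, 0, _ => 0
  | X, Y, 1, f => (∑ z ∈ X ×ˢ Y, f 0 z) / ((X.card : ℝ) * Y.card)
  | X, Y, n + 2, f =>
      (∑ i : Fin (n + 1), et X Y (n + 1) (update (Fin.tail f) i (Fin.tail f i * f 0))) -
        (∑ z ∈ X ×ˢ Y, f 0 z * et (X.erase z.1) (Y.erase z.2) (n + 1) (Fin.tail f)) / ((X.card : ℝ) * Y.card)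

/-- The junk value `Ẽ_0 = 0`. [this work] -/
theorem et_zero (X : Finset α) (Y : Finset β) (f : Fin 0 → α × β → ℝ) : et X Y 0 f = 0 := rfl

/-- `Ẽ_1(f) = (Σ_{z∈X×Y} f z) / (|X||Y|)`. [this work] -/
theorem et_one (X : Finset α) (Y : Finset β) (f : Fin 1 → α × β → ℝ) :
    et X Y 1 f = (∑ z ∈ X ×ˢ Y, f 0 z) / ((X.card : ℝ) * Y.card) := rfl

/-- **The recursion** (definitional): `Ẽ_{n+2}(f) = Σ_i Ẽ_{n+1}(tail f with slot i multiplied by f_0)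
− (Σ_{z} f_0(z)·Ẽ^{reduced}_{n+1}(tail f)) / (|X||Y|)`. [this work] -/
theorem et_succ_succ (X : Finset α) (Y : Finset β) (n : ℕ) (f : Fin (n + 2) → α × β → ℝ) :
    et X Y (n + 2) f =
      (∑ i : Fin (n + 1), et X Y (n + 1) (update (Fin.tail f) i (Fin.tail f i * f 0))) -
        (∑ z ∈ X ×ˢ Y, f 0 z * et (X.erase z.1) (Y.erase z.2) (n + 1) (Fin.tail f)) / ((X.card : ℝ) * Y.card) := rfl

/-- The recursion in `Fin.cons` form. [this work] -/
theorem et_cons (X : Finset α) (Y : Finset β) (n : ℕ) (a : α × β → ℝ) (g : Fin (n + 1) → α × β → ℝ) :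
    et X Y (n + 2) (Fin.cons a g : Fin (n + 2) → α × β → ℝ) =
      (∑ i : Fin (n + 1), et X Y (n + 1) (update g i (g i * a))) -
        (∑ z ∈ X ×ˢ Y, a z * et (X.erase z.1) (Y.erase z.2) (n + 1) g) / ((X.card : ℝ) * Y.card) := by
  rw [et_succ_succ, Fin.tail_cons, Fin.cons_zero]

/-- **The without-replacement chain average** `chainAvg Y n g` of a family `g_0,…,g_{n−1}` of functions on `β`:
`chainAvg Y (n+2) g = (1/|Y|) Σ_{y∈Y} ((n+1) − g_0(y)) · chainAvg (Y∖y) (n+1) (tail g)`, `chainAvg Y 1 g = (1/|Y|)Σ_{y∈Y} g_0 y`, `chainAvg Y 0 g = 0`.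
For an absorbing chain (`g_j g_i = g_j` for `i < j`, e.g. indicators of nested sets `V_0 ⊇ V_1 ⊇ ⋯`) this is the value of `Ẽ_n` on the family
`(g_i ∘ Prod.snd)` (full-width bands), and it is visibly `≥ 0` when `0 ≤ g_i ≤ 1`: the without-replacement form of the Lieb–Sahi chain product
formula [LiebSahi2021, Lemma 3.2] / of the nonnegativity of the polarised `E_n` on nested hold-sets. [this work] -/
def chainAvg : Finset β → (n : ℕ) → (Fin n → β → ℝ) → ℝ
  | _, 0, _ => 0
  | Y, 1, g => (∑ y ∈ Y, g 0 y) / (Y.card : ℝ)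
  | Y, n + 2, g => (∑ y ∈ Y, (((n : ℝ) + 1) - g 0 y) * chainAvg (Y.erase y) (n + 1) (Fin.tail g)) / (Y.card : ℝ)

/-- `chainAvg Y 0 g = 0`. [this work] -/
theorem chainAvg_zero (Y : Finset β) (g : Fin 0 → β → ℝ) : chainAvg Y 0 g = 0 := rfl

/-- `chainAvg Y 1 g = (Σ_{y∈Y} g_0 y)/|Y|`. [this work] -/
theorem chainAvg_one (Y : Finset β) (g : Fin 1 → β → ℝ) : chainAvg Y 1 g = (∑ y ∈ Y, g 0 y) / (Y.card : ℝ) := rfl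

/-- The recursion of `chainAvg` (definitional). [this work] -/
theorem chainAvg_succ_succ (Y : Finset β) (n : ℕ) (g : Fin (n + 2) → β → ℝ) :
    chainAvg Y (n + 2) g =
      (∑ y ∈ Y, (((n : ℝ) + 1) - g 0 y) * chainAvg (Y.erase y) (n + 1) (Fin.tail g)) / (Y.card : ℝ) := rfl

end SahiTwoChain

end Summit.CriticalPhenomena.PercolationContinuityZ3.Theorems
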